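import Mathlib.Data.Set.Card
import Mathlib.Data.Set.Finite.List
import Literature.Computability.Complexity.Counting
import Literature.Probability.LatticeModels.LatticeGraph
import HarnessLib

/-!
# Barrier (CriticalPhenomena / SAWScalingLimit): counting self-avoiding walks in subgraphs of
# `ℤ²` is `#P`-complete (Liśkiewicz–Ogihara–Toda 2003) — no polynomial-time exact formula for
# SAW counts / partition functions of general finite sub-domains of the square lattice unless
# `#P ⊆ FP`

Barrier catalogue `Literature/Barriers/CriticalPhenomena/` (D-0021), sub-problem
`SAWScalingLimit` (`Literature.Probability.RandomPlanarGeometry.SAW.SAWScalingLimit`: for every Dobrushin domain, the law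
`P_δ(γ) ∝ x_c^{|γ|}` on self-avoiding walks of `Ω_δ ⊆ δℤ²` from `a_δ` to `b_δ` — normalised by
the partition function `Z_δ = Σ_n c_n(Ω_δ; a_δ, b_δ) x_cⁿ`, `Literature.Probability.RandomPlanarGeometry.SAW.weight`/`Literature.Probability.RandomPlanarGeometry.SAW.law` —
converges to chordal SLE_{8/3}). The numbers `c_n(Ω; a, b)` of `n`-step SAWs between two points
of a finite subgraph `Ω` of `ℤ²` (and their sum over `n`) are the objects of the counting problems
below.

## What the source prints (Liśkiewicz–Ogihara–Toda, TCS 304 (2003) 129–156)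

* §1: "A self-avoiding walk (SAW) is a path on a graph that does not visit any node more than
  once … By 'two-dimensional grid' we mean the two-dimensional rectangular lattice `ℤ²` with
  origin `(0,0)`"; "Valiant [26] … showed that the problem of computing the number of all simple
  `s`-`t` paths is `#P`-complete under polynomial parsimonious reductions"; "Welsh [27] asked
  whether the exact counting problem for the two-dimensional grid is complete for `#P₁`, i.e. the
  'tally' version of `#P`, if the length of walks is specified by a tally string. If the answer
  to this question is affirmative then it could mean that determining the strict value for `c_n`
  may be computationally intractable and hence that no exact formula for `c_n` exists";
  footnote 3: "Strong evidence exists that the problem [for the full grid] is unlikely to be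
  `#P`-complete: the problem is not `#P`-complete unless the polynomial hierarchy collapses to
  `Σ₂ᵖ` … [and] unless the counting polynomial hierarchy collapses"; "settling the question of
  whether the problem is `#P₁`-hard appears to be difficult. The difficulty seems to lie in the
  fact that the two-dimensional grid has a very rigid, regular structure"; "This leads us to the
  question of whether the counting problem is hard for some complexity class if it is permitted
  to create holes, i.e., if the graphs in which SAWs are counted are those composed of the nodes
  and the edges of the two-dimensional grid"; "Our question is very different from the question
  of Welsh. An answer to our question does not necessarily shed light on the original problem";
  "The problem of counting SAWs in subgraphs of two-dimensional grids is `#P`-complete under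
  polynomial-time function reductions where the post-computation … is simply right-bitshifting
  the count"; "regardless of whether the length of the SAWs is specified or not and regardless of
  whether the end points of the SAWs are specified"; "Randall and Sinclair [20] present Monte
  Carlo algorithms for approximating the value of `c_n`, and for generating SAWs of a given
  length almost uniformly at random".
* §2.1: "`#P` of Valiant [25], defined as `{#acc_M | M is a polynomial-time nondeterministic
  Turing machine}`". §2.2: "`f` is polynomial-time one-Turing reducible to `g` … if there is a pair
  of polynomial time computable functions, `R₁ : Σ* → Σ*` and `R₂ : Σ* × ℕ → ℕ`, such that for
  all `x`, `f(x) = R₂(x, g(R₁(x)))`"; parsimonious: `R₂(x, y) = y`; "`f` is polynomial-time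
  right-bit-shift reducible to `g`, denoted by `f ≤ᵖ_{r-shift} g`, if there is a polynomial-time
  computable function `R₃ : Σ* → ℕ − {0}` such that for all `x` and `y` it holds that
  `R₂(x, y) = y div 2^{R₃(x)}`, i.e., for all `x`, `f(x) = g(R₁(x)) div 2^{R₃(x)}`";
  Proposition 1 (both reducibilities are transitive).
* §3: Lemma 4 ("The problem of counting Hamiltonian paths in planar graphs of maximum degree
  three is `#P`-complete under `≤ᵖ_{r-shift}`-reductions"), Lemma 5, Corollary 6
  (`#HamCycle-Plan3`).
* §4: the six versions — "(1) the SAWs from the origin to a specific point having a specific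
  length, (2) the SAWs from the origin to any point having a specific length, (3) the SAWs
  between any two points having a specific length, (4) the SAWs from the origin to a specific
  point having any length, (5) the SAWs from the origin to any point having any length, (6) the
  SAWs between any two points having any length" — and **Theorem 7**: "Each of the six types of
  the problem of counting the number of SAWs in subgraphs of two-dimensional grids is complete
  for `#P` under `≤ᵖ_{r-shift}`-reductions." (Proof: a planar max-degree-3 graph is embedded in
  the grid, edges stretched to paths of equal length `L²` by inserting "towers", so that
  Hamiltonian paths become the SAWs of length `h = L²(N+1)`; for the any-length versions chains
  of unit squares `S(p, q, r)` multiply the count of each realised edge by `2^q`.)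
* §4 of the same paper: "Istrail … proves that the problem [Ising ground states] remains
  NP-hard for every non-planar lattice"; for contrast, Barahona 1982, §1: "In Fisher (1966) it
  has been shown that, for any planar lattice, the [Ising] partition function can be computed by
  counting perfect matchings (dimers) in an expanded lattice. This can be accomplished in
  polynomial time by computing an appropriate Pfaffian (or determinant)", §3: "a unifying
  framework to solve, in polynomial time, for any planar lattice … computing the partition
  function".

## What is formalised (namespace `Literature.Barriers.CriticalPhenomena`, auxiliaries in `GridSAW`)

Exact objects for versions (1) and (4) (origin to a specified point; fixed length / any length),
over an explicit Boolean encoding built from the tree's combinators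
(`Literature.Computability.Complexity.encodingIntBool`, `Encoding.pairBool`, `Encoding.listBool`, `encodingNatBool`):
`GridSAW.IsGridEdge`, `IsGridSubgraph` (an instance is a finite list of grid edges — arbitrary,
not necessarily induced, subgraphs "composed of the nodes and the edges of the two-dimensional
grid"), `IsSAWIn`, `sawsFromOriginTo`, `sawCountFixedLength`, `sawCountAnyLength` (finite sets:
`sawsFromOriginTo_finite`), the string functions `SAWCOUNT₁`, `SAWCOUNT₄` (invalid codes ↦ `0`),
`RShiftReducible` and `IsSharpPCompleteRShift` (§2.2, over `Literature.Computability.Complexity.FP`, `SharpP`), the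
named facts `LOT2003_thm7_fixedLength`, `LOT2003_thm7_anyLength` (Theorem 7, versions (1), (4)),
the technique classes `HasPolyTimeSAWCount`, `HasPolyTimeSAWCountFixedLength` (HYPOTHESES of the
barrier, registered as open statements — see "Verdict clean-up" below) and the barrier
`GridSAWCountingSharpPComplete` (= Theorem 7 (1) ∧ (4); a named fact, not proved here). Versions (2), (3), (5), (6) and the
hypercube results (§5) are quoted above, not formalised. The choice of encoding is immaterial
up to polynomial-time parsimonious inter-reducibility (Prop. 1); conventions on degenerate
instances (length-`0` walks, the end point equal to the origin) do not affect hardness, which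
only uses the instances produced by the reduction. An `EdgeList` cannot carry isolated
vertices, so the instance class is slightly narrower than "subgraphs" as printed — immaterial
for Theorem 7 (the reduction never produces isolated vertices; at most the count of the
length-`0` walk at an isolated origin differs).

## Library search / why a list model

The tree already has the square lattice as `Literature.StatMech.zdGraph 2` on
`Literature.StatMech.Site 2 = Fin 2 → ℤ` (`Literature/Probability/LatticeModels/LatticeGraph.lean`,
`zdGraph_adj_iff`), self-avoiding walks on it as paths `SimpleGraph.Walk.IsPath`
(`Literature.Probability.RandomPlanarGeometry.SAW.count`, `Literature/Probability/RandomPlanarGeometry/SelfAvoidingWalk.lean`) and the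
domain walks `Literature.Probability.RandomPlanarGeometry.SAW.DomainSAW` of the sub-problem; the sibling barrier
`SAPAnisotropicNotDFinite.lean` reuses `zdGraph`. The counting problems of Theorem 7 are
functions on BIT STRINGS coding finite subgraphs, so instances are modelled here as finite edge
LISTS over `ℤ × ℤ` (directly encodable with the tree's `Encoding` combinators) and walks as
vertex lists; the bridge `GridSAW.isGridEdge_iff_zdGraph_adj` identifies the adjacency used here
with that of `zdGraph 2` under `(a, b) ↦ ![a, b]`, so `IsSAWIn E` is self-avoidance in the
subgraph of `zdGraph 2` spanned by `E` (a vertex list with pairwise distinct entries and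
`zdGraph 2`-adjacent consecutive entries is exactly the support of a `Walk.IsPath`; this last
repackaging is not carried out here).

State of the printed proof in the tree (catalogue audit 2026-08-15): the decomposition of Theorem 7
into named sub-facts (`GridSAWCountingViaGridHamPath.lean` for version (1),
`GridSAWCountingAnyLengthViaGridHamPath.lean` for version (4),
`GridSAWCountingGridHamPathHardness.lean` for Lemma 4) has been discharged step by step — both
membership halves (`GridSAW.LOT2003_thm7_fixedLength_mem_holds`,
`GridSAW.LOT2003_thm7_anyLength_mem_holds`), Proposition 1, Proposition 2 (parsimonious Cook–Levin,
`Literature.Computability.Complexity.LOT2003_prop2_sharp3SAT_holds`), Lemma 3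
(`Literature.Computability.Complexity.LOT2003_lemma3_holds`), the tower step of version (1)
(`GridSAW.LOT2003_thm7_fixedLength_towers_holds`) and the squares step of version (4)
(`GridSAW.LOT2003_thm7_anyLength_squares_holds`) are theorems (axioms `propext`, `Classical.choice`,
`Quot.sound`), and `GridSAW.gridSAWCountingSharpPComplete_of_gadgets`
(`GridSAWCountingAnyLengthAssembly.lean`) derives the barrier below from the single remaining named
fact `GridSAW.LOT2003_lemma4_gadgets` (the Garey–Johnson–Tarjan gadget reduction of Lemma 4 with the
grid embedding `E₀`, `#3SAT_NF ≤ᵖ_{r-shift} GRIDHAMPATHCOUNT`); the consequence for the technique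
class, `GridSAW.sharpP_subset_FP_of_hasPolyTimeSAWCount`, is proved in
`GridSAWCountingSharpPCompleteProofs.lean`. Those files import this one, so nothing of this is used
or restated here.

## Verdict clean-up (2026-08-15): the two technique classes are hypotheses, not literature debt

The tenured prove-seats on `GridSAW.HasPolyTimeSAWCount` (`⌜SAWCOUNT₄⌝ ∈ FP`) and
`GridSAW.HasPolyTimeSAWCountFixedLength` (`⌜SAWCOUNT₁⌝ ∈ FP`) both ended *not a fact*: each is the
barrier's TECHNIQUE CLASS (D-0021) — the hypothesis a polynomial-time exact counting method would
deliver — and not a statement of any source. Re-verified here: Liśkiewicz–Ogihara–Toda print the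
counting PROBLEMS (§4, versions (1)–(6)), POSE the hardness question (§1: "Is counting SAWs of a
specified length in subgraphs of two-dimensional grids `#P`-complete under some polynomial-time
function reductions?") and answer it by Theorem 7 (complete for `#P` under `≤ᵖ_{r-shift}`); they
assert neither polynomial-time solvability nor an unconditional lower bound. Barahona 1982 (§1,
§3.2: the planar ISING partition function "can be computed … in polynomial time by computing an
appropriate Pfaffian (or determinant)") concerns another model and was quoted only as a contrast.
In the tree, by Theorem 7 with Arora–Barak Prop. 17.9, each class is EQUIVALENT under the barrier
to `#P ⊆ FP` (`GridSAW.hasPolyTimeSAWCount_iff_sharpP_subset_FP`,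
`GridSAW.hasPolyTimeSAWCountFixedLength_iff_sharpP_subset_FP`, `GridSAW.hasPolyTimeSAWCount_iff_fixedLength`,
sibling file `GridSAWCountingSharpPCompleteProofs.lean`; the directions `#P ⊆ FP → class` need only
the proved membership halves `GridSAW.LOT2003_thm7_anyLength_mem_holds`,
`GridSAW.LOT2003_thm7_fixedLength_mem_holds`), i.e. to the affirmative answer to "the big open
question regarding `#P` … whether `#P = FP`" (Arora–Barak §17.2), which would give `NP = P`; the
no-go reading `FP ≠ #P ⟹ ¬ class` is `GridSAW.not_hasPolyTimeSAWCount_of`,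
`GridSAW.not_hasPolyTimeSAWCountFixedLength_of`. Print decides neither statement, so no `_holds`
and no unconditional `¬` can be vendored. Treatment: names and bodies kept VERBATIM (they are the
`technique_class:` tokens of the barrier block below, the hypothesis of
`GridSAW.sharpP_subset_FP_of_hasPolyTimeSAWCount`, and hypotheses/conclusions of the theorems of the
sibling proof file listed above, with `GridSAW.sharpP_subset_FP_of_hasPolyTimeSAWCountFixedLength`
there), docstrings re-headed as registered OPEN statements
(`OPEN CONJECTURE — …`, expected FALSE, `[status: open]`, CONVENTIONS §4) cited to where the
question is posed (LOT 2003, §1) and where its standing is recorded (Arora–Barak §17.2,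
Prop. 17.9); the former cite tags (LOT 2003 §1 "no exact formula for `c_n` exists", Barahona 1982
§1/§3) survive as prose. Nothing else in the file changed (the docstring of the discharged
statement `GridSAW.sharpP_subset_FP_of_hasPolyTimeSAWCount` now names its discharge).
-/

noncomputable section

namespace Literature.Barriers.CriticalPhenomena

open _root_.Computability Literature.Computability.Complexity Literature.Probability.LatticeModels

namespace GridSAW

/-! ### Subgraphs of the two-dimensional grid and their self-avoiding walks -/

/-- A node of "the two-dimensional rectangular lattice `ℤ²` with origin `(0,0)`".
[cite: LiskiewiczOgiharaToda2003, §1] -/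
abbrev GridPoint : Type := ℤ × ℤ

/-- `p`, `q` are joined by an edge of the grid `ℤ²` (they differ by `±1` in exactly one
coordinate). [cite: LiskiewiczOgiharaToda2003, §1 (two-dimensional grid)] -/
def IsGridEdge (p q : GridPoint) : Prop :=
  (p.1 = q.1 ∧ (p.2 - q.2).natAbs = 1) ∨ (p.2 = q.2 ∧ (p.1 - q.1).natAbs = 1)

/-- Decidability of `IsGridEdge` (integer arithmetic). [folklore] -/
instance (p q : GridPoint) : Decidable (IsGridEdge p q) := by
  unfold IsGridEdge; infer_instance

/-- The coordinates of a grid point as a site of the tree's lattice `Site 2 = Fin 2 → ℤ`: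
Mathlib's `(finTwoArrowEquiv ℤ).symm`, i.e. `p ↦ ![p.1, p.2]`. Librarian note: the sibling
barrier file `NienhuisWeightsExcludeVertexSAW.lean` has a private copy
`NoVertexRelation.toSite` with the same injectivity lemma; both are this Mathlib equivalence
(that file is not imported here to keep the Yang–Baxter material out of the import closure).
[cite: FriedliVelenik2017, §3.1] -/
def toSite : GridPoint → Site 2 := (finTwoArrowEquiv ℤ).symm

/-- `toSite p = ![p.1, p.2]` (Mathlib's `finTwoArrowEquiv_symm_apply`). [folklore] -/
@[simp] theorem toSite_apply (p : GridPoint) : toSite p = ![p.1, p.2] := rfl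

/-- **Bridge to the tree's square lattice**: `IsGridEdge p q` is adjacency of `![p.1, p.2]` and
`![q.1, q.2]` in `Literature.StatMech.zdGraph 2` (nearest neighbours of `ℤ²`, `zdGraph_adj_iff`:
`y = x + eᵢ ∨ x = y + eᵢ`). [cite: FriedliVelenik2017, §3.1] -/
theorem isGridEdge_iff_zdGraph_adj (p q : GridPoint) :
    IsGridEdge p q ↔ (zdGraph 2).Adj (toSite p) (toSite q) := by
  rw [zdGraph_adj_iff, Fin.exists_fin_two]
  simp only [toSite_apply, funext_iff, Fin.forall_fin_two, Pi.add_apply, Pi.single_apply,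
    Matrix.cons_val_zero, Matrix.cons_val_one]
  simp only [Fin.isValue, ↓reduceIte, one_ne_zero, add_zero, zero_ne_one]
  unfold IsGridEdge
  omega

/-- `toSite` is injective (so vertex lists with distinct entries map to distinct sites).
[folklore] -/
theorem toSite_injective : Function.Injective toSite := (finTwoArrowEquiv ℤ).symm.injective

/-- An instance: a finite list of (ordered pairs standing for undirected) edges.
[cite: LiskiewiczOgiharaToda2003, §1 ("graphs … composed of the nodes and the edges of the two-dimensional grid")] -/
abbrev EdgeList : Type := List (GridPoint × GridPoint)

/-- The list `E` is a **subgraph of the two-dimensional grid**: every listed pair is a grid edge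
(holes and missing edges allowed; the vertex set is the set of endpoints).
[cite: LiskiewiczOgiharaToda2003, §1 ("if it is permitted to create holes")] -/
def IsGridSubgraph (E : EdgeList) : Prop := ∀ e ∈ E, IsGridEdge e.1 e.2

/-- The vertex set of the subgraph `E` (endpoints of its edges). [cite: LiskiewiczOgiharaToda2003, §1] -/
def vertexSet (E : EdgeList) : Finset GridPoint := (E.map Prod.fst ++ E.map Prod.snd).toFinset

/-- Adjacency in the subgraph `E` (edges are undirected: either orientation listed).
[cite: LiskiewiczOgiharaToda2003, §1] -/
def Adj (E : EdgeList) (p q : GridPoint) : Prop := (p, q) ∈ E ∨ (q, p) ∈ E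

/-- In a subgraph of the grid, adjacency is nearest-neighbour adjacency of the tree's lattice
`zdGraph 2` (via `toSite`). [cite: LiskiewiczOgiharaToda2003, §1] [cite: FriedliVelenik2017, §3.1] -/
theorem Adj.zdGraph_adj {E : EdgeList} (hE : IsGridSubgraph E) {p q : GridPoint} (h : Adj E p q) :
    (zdGraph 2).Adj (toSite p) (toSite q) := by
  rcases h with h | h
  · exact (isGridEdge_iff_zdGraph_adj p q).mp (hE _ h)
  · exact ((isGridEdge_iff_zdGraph_adj q p).mp (hE _ h)).symm

/-- **A self-avoiding walk in the subgraph `E`**: a non-empty list of pairwise distinct vertices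
of `E`, consecutive ones adjacent in `E` ("a path on a graph that does not visit any node more
than once"); its length (number of steps) is `ω.length - 1`.
[cite: LiskiewiczOgiharaToda2003, §1 (definition of SAW)] -/
def IsSAWIn (E : EdgeList) (ω : List GridPoint) : Prop :=
  ω ≠ [] ∧ ω.Nodup ∧ (∀ p ∈ ω, p ∈ vertexSet E) ∧ List.IsChain (Adj E) ω

/-- A SAW of a grid subgraph, read on sites, is a chain of `zdGraph 2`-adjacent, pairwise
distinct sites (the support data of a `SimpleGraph.Walk.IsPath` of `zdGraph 2`, cf.
`Literature.Probability.RandomPlanarGeometry.SAW.count`). [cite: LiskiewiczOgiharaToda2003, §1] [cite: FriedliVelenik2017, §3.1] -/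
theorem IsSAWIn.map_toSite {E : EdgeList} (hE : IsGridSubgraph E) {ω : List GridPoint}
    (h : IsSAWIn E ω) :
    (ω.map toSite).Nodup ∧ List.IsChain (zdGraph 2).Adj (ω.map toSite) := by
  refine ⟨h.2.1.map toSite_injective, ?_⟩
  exact List.isChain_map_of_isChain toSite (fun a b hab => Adj.zdGraph_adj hE hab) h.2.2.2

/-- The origin `(0,0)` of the grid. [cite: LiskiewiczOgiharaToda2003, §1] -/
def gridOrigin : GridPoint := (0, 0)

/-- The SAWs of `E` from the origin to the point `t` (any length).
[cite: LiskiewiczOgiharaToda2003, §4 (versions (1) and (4))] -/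
def sawsFromOriginTo (E : EdgeList) (t : GridPoint) : Set (List GridPoint) :=
  {ω | IsSAWIn E ω ∧ ω.head? = some gridOrigin ∧ ω.getLast? = some t}

/-- Version (1): the number of SAWs of `E` "from the origin to a specific point having a specific
length" `n` (i.e. `n + 1` vertices). [cite: LiskiewiczOgiharaToda2003, §4 (version (1))] -/
def sawCountFixedLength (E : EdgeList) (t : GridPoint) (n : ℕ) : ℕ :=
  {ω ∈ sawsFromOriginTo E t | ω.length = n + 1}.ncard

/-- Version (4): the number of SAWs of `E` "from the origin to a specific point having any
length". [cite: LiskiewiczOgiharaToda2003, §4 (version (4))] -/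
def sawCountAnyLength (E : EdgeList) (t : GridPoint) : ℕ :=
  (sawsFromOriginTo E t).ncard

/-- Lists of pairwise distinct elements of a finite set form a finite set (so the counts above are
honest cardinalities, not junk values of `Set.ncard`). [folklore] -/
theorem finite_nodup_subset {α : Type*} [DecidableEq α] (S : Finset α) :
    {ω : List α | ω.Nodup ∧ ∀ p ∈ ω, p ∈ S}.Finite := by
  have hfin : {l : List ↥S | l.length ≤ S.card}.Finite := List.finite_length_le _ _
  refine (hfin.image (List.map Subtype.val)).subset ?_
  rintro ω ⟨hnd, hmem⟩
  refine ⟨ω.pmap (fun p hp => (⟨p, hp⟩ : ↥S)) (fun p hp => hmem p hp), ?_, ?_⟩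
  · show (ω.pmap _ _).length ≤ S.card
    rw [List.length_pmap, ← List.toFinset_card_of_nodup hnd]
    exact Finset.card_le_card fun p hp => hmem p (List.mem_toFinset.mp hp)
  · rw [List.map_pmap]
    simp

/-- The set of SAWs of a finite subgraph is finite. [folklore] -/
theorem isSAWIn_finite (E : EdgeList) : {ω | IsSAWIn E ω}.Finite :=
  (finite_nodup_subset (vertexSet E)).subset fun _ h => ⟨h.2.1, h.2.2.1⟩

/-- The set of SAWs from the origin to `t` is finite. [folklore] -/
theorem sawsFromOriginTo_finite (E : EdgeList) (t : GridPoint) : (sawsFromOriginTo E t).Finite :=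
  (isSAWIn_finite E).subset fun _ h => h.1

/-! ### Boolean encodings of instances and the counting functions on strings -/

/-- Grid points as bit strings (pair of sign–magnitude integers).
[cite: AroraBarak2009, §0.1 (representing pairs and tuples)] -/
def encodingGridPoint : Encoding GridPoint Bool := encodingIntBool.pairBool encodingIntBool

/-- Edge lists as bit strings. [cite: AroraBarak2009, §0.1] -/
def encodingEdgeList : Encoding EdgeList Bool :=
  (encodingGridPoint.pairBool encodingGridPoint).listBool

/-- Instances `(E, t, n)` of version (1) (`n` in binary). [cite: AroraBarak2009, §0.1] -/
def encodingFixedLengthInstance : Encoding (EdgeList × GridPoint × ℕ) Bool :=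
  encodingEdgeList.pairBool (encodingGridPoint.pairBool encodingNatBool)

/-- Instances `(E, t)` of version (4). [cite: AroraBarak2009, §0.1] -/
def encodingAnyLengthInstance : Encoding (EdgeList × GridPoint) Bool :=
  encodingEdgeList.pairBool encodingGridPoint

open Classical in
/-- **`SAWCOUNT₁ : {0,1}* → ℕ`**, version (1) of the counting problem as a function on strings:
on the code of `(E, t, n)` with `E` a subgraph of the grid, the number of SAWs of `E` from the
origin to `t` of length `n`; `0` on strings that are not codes of instances.
[cite: LiskiewiczOgiharaToda2003, §4 (version (1))] -/
def SAWCOUNT₁ : List Bool → ℕ := fun w =>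
  match encodingFixedLengthInstance.decode w with
  | some (E, t, n) => if IsGridSubgraph E then sawCountFixedLength E t n else 0
  | none => 0

open Classical in
/-- **`SAWCOUNT₄ : {0,1}* → ℕ`**, version (4): on the code of `(E, t)` with `E` a subgraph of the
grid, the number of SAWs of `E` from the origin to `t` of any length; `0` on non-codes.
[cite: LiskiewiczOgiharaToda2003, §4 (version (4))] -/
def SAWCOUNT₄ : List Bool → ℕ := fun w =>
  match encodingAnyLengthInstance.decode w with
  | some (E, t) => if IsGridSubgraph E then sawCountAnyLength E t else 0
  | none => 0

/-- `SAWCOUNT₁` on a code word is the mathematical count. [cite: LiskiewiczOgiharaToda2003, §4] -/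
theorem SAWCOUNT₁_encode (E : EdgeList) (t : GridPoint) (n : ℕ) (hE : IsGridSubgraph E) :
    SAWCOUNT₁ (encodingFixedLengthInstance.encode (E, t, n)) = sawCountFixedLength E t n := by
  simp [SAWCOUNT₁, encodingFixedLengthInstance.decode_encode, hE]

/-- `SAWCOUNT₄` on a code word is the mathematical count. [cite: LiskiewiczOgiharaToda2003, §4] -/
theorem SAWCOUNT₄_encode (E : EdgeList) (t : GridPoint) (hE : IsGridSubgraph E) :
    SAWCOUNT₄ (encodingAnyLengthInstance.encode (E, t)) = sawCountAnyLength E t := by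
  simp [SAWCOUNT₄, encodingAnyLengthInstance.decode_encode, hE]

/-! ### Right-bit-shift reductions and `#P`-completeness (§2.2) -/

/-- **`f ≤ᵖ_{r-shift} g`** (polynomial-time right-bit-shift reducibility between counting
functions): there are polynomial-time computable `R₁ : Σ* → Σ*` and `R₃ : Σ* → ℕ − {0}` (the
latter as the binary string `encodeNat (R₃ x)`) with `f(x) = g(R₁(x)) div 2^{R₃(x)}` for all `x`
— the special case `R₂(x, y) = y div 2^{R₃(x)}` of a polynomial-time one-Turing reduction.
Polynomial time is the tree's `Literature.Computability.Complexity.FP`.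
[cite: LiskiewiczOgiharaToda2003, §2.2 (definition of ≤ᵖ_{r-shift})] -/
def RShiftReducible (f g : List Bool → ℕ) : Prop :=
  ∃ R₁ : List Bool → List Bool, R₁ ∈ FP ∧
    ∃ R₃ : List Bool → ℕ, (encodeNat ∘ R₃) ∈ FP ∧ (∀ x, 0 < R₃ x) ∧
      ∀ x, f x = g (R₁ x) / 2 ^ (R₃ x)

/-- **`g` is complete for `#P` under `≤ᵖ_{r-shift}`-reductions**: `g ∈ #P`
(`Literature.Computability.Complexity.SharpP`, Valiant's class) and every `f ∈ #P` is `≤ᵖ_{r-shift}`-reducible to `g`.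
An r-shift reduction is a special polynomial-time one-Turing reduction (one oracle query, then a
shift), so this is a STRONGER notion than Cook hardness `Literature.CplxCore.IsSharpPHardFun g`
(`#P ⊆ FP^g`); the implication is not derived here (it needs the oracle-machine closure facts of
`Oracle.lean`). [cite: LiskiewiczOgiharaToda2003, §2.1–§2.2] [cite: Valiant1979, §2] -/
def IsSharpPCompleteRShift (g : List Bool → ℕ) : Prop :=
  g ∈ SharpP ∧ ∀ f ∈ SharpP, RShiftReducible f g

/-- Unfolding lemma: `RShiftReducible f g` is the printed formula
`f(x) = g(R₁(x)) div 2^{R₃(x)}` with `R₁`, `R₃` polynomial-time and `R₃ ≥ 1`.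
[cite: LiskiewiczOgiharaToda2003, §2.2] -/
theorem rShiftReducible_iff (f g : List Bool → ℕ) :
    RShiftReducible f g ↔ ∃ R₁ : List Bool → List Bool, R₁ ∈ FP ∧
      ∃ R₃ : List Bool → ℕ, (encodeNat ∘ R₃) ∈ FP ∧ (∀ x, 0 < R₃ x) ∧
        ∀ x, f x = g (R₁ x) / 2 ^ (R₃ x) :=
  Iff.rfl

/-! ### Theorem 7 (versions (1) and (4)) as named facts -/

/-- **Theorem 7, version (1)** of Liśkiewicz–Ogihara–Toda 2003: counting "the SAWs from the
origin to a specific point having a specific length" in subgraphs of two-dimensional grids is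
complete for `#P` under `≤ᵖ_{r-shift}`-reductions. (Named fact; the printed proof embeds
`#HamPath` for planar graphs of maximum degree three, Lemma 4, into the grid with all edges
stretched to paths of length `L²`.) [cite: LiskiewiczOgiharaToda2003, Theorem 7 (version (1)) and Lemma 4] -/
def LOT2003_thm7_fixedLength : Prop :=
  IsSharpPCompleteRShift SAWCOUNT₁

/-- **Theorem 7, version (4)** of Liśkiewicz–Ogihara–Toda 2003: counting "the SAWs from the
origin to a specific point having any length" in subgraphs of two-dimensional grids is complete
for `#P` under `≤ᵖ_{r-shift}`-reductions (the construction `E₃` with `β = L²` unit squares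
attached along each realised edge). [cite: LiskiewiczOgiharaToda2003, Theorem 7 (version (4))] -/
def LOT2003_thm7_anyLength : Prop :=
  IsSharpPCompleteRShift SAWCOUNT₄

/-! ### The technique class and the barrier -/

/-- OPEN CONJECTURE — a registered open statement in the sense of CONVENTIONS §4, expected to be
FALSE: **the technique class `HasPolyTimeSAWCount`** of the barrier `GridSAWCountingSharpPComplete`,
a HYPOTHESIS coined for this barrier (D-0021), not a result of any source and not literature debt
(verdict clean-up 2026-08-15, module docstring: it formerly carried cite tags to
Liśkiewicz–Ogihara–Toda 2003, §1 and Barahona 1982, §1/§3, neither of which asserts it; no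
`HasPolyTimeSAWCount_holds` is, or is meant to be, sought). THE STATEMENT: `⌜SAWCOUNT₄⌝ ∈ FP`
(`⌜·⌝ = encodeNat`, output in binary) — a polynomial-time exact evaluation of the number of
self-avoiding walks from the origin to a given point of an ARBITRARY finite subgraph of `ℤ²`
(version (4)): what a closed formula, a polynomial-size transfer matrix, or a
determinant/Pfaffian expression of Kasteleyn–Fisher type evaluable in polynomial time would
provide — such as exists for the planar Ising partition function ("for any planar lattice, the
partition function can be computed by counting perfect matchings (dimers) in an expanded lattice
… in polynomial time by computing an appropriate Pfaffian (or determinant)", Barahona 1982, §1,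
carried out in §3.2; a CONTRAST fixing the shape of the class, not a source of the statement).
POSED, as a question about hardness, in [cite: LiskiewiczOgiharaToda2003, §1] ("whether the
counting problem is hard for some complexity class if it is permitted to create holes"; on
Welsh's full-grid question: hardness "could mean that determining the strict value for `c_n` may
be computationally intractable and hence that no exact formula for `c_n` exists") and answered
there in the completeness sense only (Theorem 7). STANDING: print decides the statement neither
way — by Theorem 7 (4) with [cite: AroraBarakCC2009, Prop. 17.9] ("If `f` is `#P`-complete and
`f ∈ FP`, then `FP = #P`") it is EQUIVALENT, under the barrier, to `#P ⊆ FP`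
(`GridSAW.hasPolyTimeSAWCount_iff_sharpP_subset_FP`, sibling file
`GridSAWCountingSharpPCompleteProofs.lean`; the direction `#P ⊆ FP → HasPolyTimeSAWCount` needs
only the proved membership `GridSAW.LOT2003_thm7_anyLength_mem_holds : SAWCOUNT₄ ∈ #P`), i.e. to
the affirmative answer to "the big open question regarding `#P` … whether `#P = FP`", under
which "`NP = P`" [cite: AroraBarakCC2009, §17.2 (after Def. 17.5)]: a discharge would be a
polynomial-time algorithm for a `#P`-complete function, a refutation a proof of `FP ≠ #P`
(conditional no-go form: `GridSAW.not_hasPolyTimeSAWCount_of`). The name is kept (not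
`…Conjecture`): it is the `technique_class:` token of the barrier block and the hypothesis
`(h : HasPolyTimeSAWCount)` of `GridSAW.sharpP_subset_FP_of_hasPolyTimeSAWCount` and of the
sibling proof file. [status: open] -/
def HasPolyTimeSAWCount : Prop :=
  (encodeNat ∘ SAWCOUNT₄) ∈ FP

/-- OPEN CONJECTURE — a registered open statement (CONVENTIONS §4), expected to be FALSE: **the
fixed-length variant `HasPolyTimeSAWCountFixedLength` of the technique class**, a HYPOTHESIS of
the barrier, not a result of any source and not literature debt (verdict clean-up 2026-08-15:
formerly cite-tagged to Liśkiewicz–Ogihara–Toda 2003, §1 and §4, which print the counting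
PROBLEM — version (1) — and its `#P`-completeness, not its polynomial-time solvability; no
`_holds` is sought). THE STATEMENT: `⌜SAWCOUNT₁⌝ ∈ FP` — polynomial-time exact evaluation of
`c_n(E; 0, t)`, the number of `n`-step SAWs from the origin to `t` in an arbitrary finite
subgraph `E` of `ℤ²`, i.e. of the coefficients of the two-point generating function
`Σ_n c_n(E; 0, t) xⁿ` (version (1), "the SAWs from the origin to a specific point having a
specific length"). POSED as the question of [cite: LiskiewiczOgiharaToda2003, §1] ("Is counting
SAWs of a specified length in subgraphs of two-dimensional grids `#P`-complete under some
polynomial-time function reductions?"), answered by Theorem 7 in the completeness sense only.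
STANDING: as for `HasPolyTimeSAWCount` — by Theorem 7 (1) with [cite: AroraBarakCC2009, Prop. 17.9]
equivalent, under the barrier, to `#P ⊆ FP`
(`GridSAW.hasPolyTimeSAWCountFixedLength_iff_sharpP_subset_FP`; membership
`GridSAW.LOT2003_thm7_fixedLength_mem_holds : SAWCOUNT₁ ∈ #P` proved; the two classes are
equivalent to each other under the barrier, `GridSAW.hasPolyTimeSAWCount_iff_fixedLength`), "the
big open question regarding `#P`" [cite: AroraBarakCC2009, §17.2 (after Def. 17.5)]; conditional
no-go form `GridSAW.not_hasPolyTimeSAWCountFixedLength_of`. Name kept (a `technique_class:` token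
of the barrier block; hypothesis of `GridSAW.sharpP_subset_FP_of_hasPolyTimeSAWCountFixedLength`).
[status: open] -/
def HasPolyTimeSAWCountFixedLength : Prop :=
  (encodeNat ∘ SAWCOUNT₁) ∈ FP

end GridSAW

/-- **Barrier `GridSAWCountingSharpPComplete`** (Liśkiewicz–Ogihara–Toda 2003, Theorem 7,
versions (1) and (4), AS PRINTED modulo the explicit encoding): the functions `SAWCOUNT₁`
(number of SAWs of a given subgraph of `ℤ²` from the origin to a given point with a given
length) and `SAWCOUNT₄` (same, any length) are complete for `#P` under polynomial-time
right-bit-shift reductions. A named fact (`Prop`), not proved here.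

BARRIER (structured block, D-0021):
- technique_class: exact-enumeration closed-form polynomial-time-counting transfer-matrix Pfaffian-determinant-formula (`HasPolyTimeSAWCount`, `HasPolyTimeSAWCountFixedLength`: polynomial-time exact evaluation, for ARBITRARY finite subgraphs of `ℤ²`, of the two-point SAW counts `c_n(E; 0, t)` / `Σ_n c_n(E; 0, t)` — the numbers entering the partition functions `Z = Σ_γ x^{|γ|}` of SAW laws between two points such as `Literature.Probability.RandomPlanarGeometry.SAW.weight`, `Literature.Probability.RandomPlanarGeometry.SAW.law`)
- blocks: a Kasteleyn–Fisher-type solution of the planar SAW two-point problem on general sub-domains — for the planar Ising model "for any planar lattice, the partition function can be computed by counting perfect matchings (dimers) … in polynomial time by computing an appropriate Pfaffian (or determinant)" [cite: Barahona1982, §1 and §3], whereas by Theorem 7 a polynomial-time exact count of SAWs between two points of arbitrary subgraphs of `ℤ²` (with or without prescribed length, with or without prescribed end points: six versions) would put every `#P` function in `FP` [cite: LiskiewiczOgiharaToda2003, Theorem 7 and §2.2]; the source's own reading of such hardness: it "could mean that determining the strict value for `c_n` may be computationally intractable and hence that no exact formula for `c_n` exists" [cite: LiskiewiczOgiharaToda2003,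 §1]
- because: `#3SAT ≤ᵖ_{r-shift} #HamPath` for planar graphs of maximum degree three (a corrected Garey–Johnson–Tarjan reduction through NAE3SAT, each satisfying assignment contributing exactly `2^{48r+12n+312m+25}` Hamiltonian paths) [cite: LiskiewiczOgiharaToda2003, Lemma 3, Lemma 4]; the planar graph is embedded in the grid without vertex congestion, enlarged, and every edge is stretched by "towers" to a lattice path of the same length `L²`, so that Hamiltonian `s'`–`t'` paths are exactly the SAWs of length `h = L²(N+1)` (versions (1)–(3)); attaching `β = L²` unit squares along each realised edge multiplies each such walk by `2^{β(N+1)}` and drowns all shorter walks below one right-shift (versions (4)–(6)) [cite: LiskiewiczOgiharaToda2003, §4 (proof of Theorem 7)]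
- evasions_known: approximate counting and almost-uniform sampling by Monte Carlo for the TRANSLATION-INVARIANT full-lattice numbers `c_n` ("Randall and Sinclair [20] present Monte Carlo algorithms for approximating the value of `c_n`, and for generating SAWs of a given length almost uniformly at random") [cite: LiskiewiczOgiharaToda2003, §1] [cite: RandallSinclair2000, Abstract] — a problem the theorem does not cover (see `scope_caveats`); NOT an evasion on the theorem's own instance class (catalogue audit 2026-08-15, gen 2; details and the proved arithmetic in `GridSAWCountingAnyLengthViaGridHamPath.lean`, audit appendix): on the hard instances of version (1) the count `SAWCOUNT₁(E₂, τ, h)` "is exactly the number of Hamiltonian paths in `G′`" [cite: LiskiewiczOgiharaToda2003, §4 (proof of Theorem 7, E₂)], which is positive iff the coded formula is satisfiable ("each Hamiltonian path of `G` corresponds to a satisfying assignment of `ψ`"; Lemma 5: the same map is a many-one reduction from `3SAT`) [cite: LiskiewiczOgiharaToda2003, §3 (proof of Lemma 4) and Lemma 5] — on induced instances directly: Hamiltonicity of grid graphs is NP-complete [cite: ItaiPapadimitriouSzwarcfiter1982, main theorem (via MITHardnessGroup2024, §1)] and an `n`-vertex SAW of an `n`-vertex grid graph is a Hamiltonian path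 — so the fixed-length two-point count admits no polynomial-time approximation within ANY factor unless `P = NP`, and no FPRAS unless `NP = RP` ("If there exists an NP-complete decision problem `A` such that `#A` is in FPRAS, then RP = NP") [cite: Miklos2019, Theorem 15]; for version (4) the squares of `E₃` are the Jerrum–Valiant–Vazirani amplification ("it is NP-hard to have a polynomial approximation for the number of cycles in a directed graph", by chains of diamonds) [cite: Miklos2019, Theorems 16–17] [cite: JerrumValiantVazirani1986, hardness of approximately counting directed cycles (via Miklos2019, §1.6)]: `SAWCOUNT₄(E₃, τ) = Σ_π 2^{β|π|}` over the simple `s′`–`t′` paths `π` of `G′` ("`e` is realized by a set of `2^β` paths") is at least `2^{β(N+1)}` if `G′` has a Hamiltonian `s′`–`t′` path and less than `2^{βN+N+1}` otherwise (fewer than `2^{N+1}` simple paths leave the degree-one node `s′` in a graph of maximum degree three; `β = L²`, `L ≥ N²`) [cite: LiskiewiczOgiharaToda2003, §4 (proof of Theorem 7, E₂ and E₃: "Since β ≥ N …")], a multiplicative gap `2^{β−N−1} ≥ 2^{N⁴−N−1}`, so approximating the any-length two-point count within a factor `2^{m^c}` (`m` the instance size, some fixed `c > 0`) decides `3SAT`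 as well (informal reading of the printed construction, not formalised; its arithmetic is `GridSAW.exists_ham_iff_two_pow_le_of_approx`); exactly solvable restricted classes, e.g. up-side (partially directed) SAWs recognised by a finite automaton, with a closed formula for their number [cite: LiskiewiczOgiharaToda2003, §6 (up-side SAWs)]; the TRANSLATION-INVARIANT full-grid problem (`c_n` itself, Welsh's Problem 1.7.3) is not covered by the theorem and is "unlikely to be `#P`-complete" (it is in `#P₁`; `#P`-completeness would collapse the polynomial and counting hierarchies) [cite: LiskiewiczOgiharaToda2003, §1, footnote 3]; on the hexagonal lattice the critical point `x_c = 1/√(2+√2)` is identified exactly without any counting formula, by the parafermionic observable [cite: DuminilCopinSmirnov2012, Theorem 1]; NOT an evasion (catalogue audit 2026-08-14): restricting the instances to INDUCED subgraphs of `ℤ²` ("grid graphs": the vertices a finite subset of `ℤ²`, an edge exactly between points at distance one) or to spanning subgraphs of a full rectangle — Hamiltonicity of undirected maximum-degree-three grid graphs is ASP-complete (parsimonious reductions from every NP search problem), "as a consequence … counting Hamiltonian cycles is #P-complete" [cite: MITHardnessGroup2024, Theorem 4.10 and §1], and likewise for maximum-degree-three spanning subgraphs of rectangular grid graphs [cite: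 MITHardnessGroup2024, Theorem 4.9]; deleting a vertex `v` of degree two (the lowest-leftmost vertex of a finite grid graph has degree at most two, and fewer than two excludes Hamiltonian cycles) turns the Hamiltonian cycles bijectively into the Hamiltonian paths of `G − v` (again an induced grid graph, resp. a spanning subgraph of a rectangle minus one corner) between the two neighbours of `v`, and the Hamiltonian paths of an `n`-vertex induced grid graph between two of its points are exactly its `n`-vertex self-avoiding walks between them [folklore], so version (1) (`SAWCOUNT₁`, one end point translated to the origin) stays `#P`-hard — under parsimonious reductions and without any tower — already on induced instances of maximum degree three
- scope_caveats: the hard instances of the PRINTED proof are arbitrary subgraphs of `ℤ²` with holes and individually deleted edges (the "towers" of width one and the attached unit squares "with a gap of unit length in between" are not induced subgraphs) [cite: LiskiewiczOgiharaToda2003, §4 (proof of Theorem 7: E₂, E₃, S(p, q, r))]; holes alone (induced subgraphs of maximum degree three) and edge deletions alone (all vertices of a rectangle kept — minus one corner after the vertex deletion that passes to version (1)) each already carry the hardness of the fixed-length version [cite: MITHardnessGroup2024, Theorem 4.10 and Theorem 4.9], so the structural refuge that remains is SIMPLE CONNECTIVITY: nothing is asserted about solid domains (no holes: every bounded face a unit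 square), and for the vertex-induced ones ("solid grid graphs") even Hamiltonicity is decidable in polynomial time [cite: UmansLenhart1997, main theorem (abstract; via Nishat–Whitesides, COCOON 2017, p. 445)] while no counting hardness is recorded for them; the discretisations `Ω_δ` of the Jordan (Dobrushin) domains of `Literature.Probability.RandomPlanarGeometry.SAW.SAWScalingLimit` (the tree's `Literature.Probability.LatticeModels.discreteDomainGraph`: mesh points of `Ω`, an edge only when the closed segment lies in `Ω̄`, largest component) are solid induced grid graphs only for tame `Ω` (e.g. convex): in general a boundary fjord narrower than the mesh deletes the edges it crosses while keeping both end points, so `Ω_δ` is a NON-induced subgraph — still without bounded non-square faces for a Jordan domain (a bounded complementary region of `Ω_δ` cannot meet the exterior of the curve, which is connected, unbounded and disjoint from the closed edge segments; informal, not formalised here) — hence covered neither by the solid-grid-graph algorithm as stated nor, as far as recorded, by any of the hardness constructions above; nothing is asserted about the `Ω_δ`, nor about `c_n = Literature.Probability.RandomPlanarGeometry.SAW.count n` ("Our question is very different from the question of Welsh. An answer to our question does not necessarily shed light on the original problem") [cite: LiskiewiczOgiharaToda2003, §1]; prescribing both end points on the OUTER BOUNDARY (as for the Dobrushin domains, `a,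 b ∈ ∂Ω`) is no refuge as far as the printed hard family goes (catalogue audit 2026-08-15): `s`, `t` are exterior nodes of Lemma 4's graph and the embedding `E₀` draws the pendant ends outside, `s′` at the lowest-leftmost and `t′` at the highest-rightmost node image ("Since `s` and `t` are both exterior nodes, we may assume that `s′` is mapped to the node with the smallest `x`-coordinate among those in `U` having the smallest `y`-coordinate and `t′` is mapped to the node with the largest `x`-coordinate among those in `U` having the largest `y`-coordinate") [cite: LiskiewiczOgiharaToda2003, §4 (proof of Theorem 7, construction of E₀)] (informal reading of the construction; the tree's `GRIDHAMPATHCOUNT` carries arbitrary drawings and does not track faces); the theorem is conditional hardness (`#P`-completeness), not an unconditional lower bound, and says nothing about scaling limits (nor, as a statement, about approximate counting — its PROOF does, see `evasions_known`); TRANSFER MATRICES are limited by their own state space, not by the theorem (catalogue audit 2026-08-15, gen 2): Klein (1980) "used 'transfer matrices' to analyze self-avoiding walks in" the strips `ℤ × {0, …, T}` "as well as in more general 'one-dimensional' lattice subsets" [cite: MadrasSlade1993, §8.5 Notes (p. 278)], and at FIXED width the two-point counts of a subgraph of a strip obey the bounded-state recursion of that method in time polynomial in the length — exponential only in the width, which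 for the `Ω_δ` is `≍ 1/δ` (informal, not formalised); likewise an EXACT SOLUTION of the homogeneous model in the sense of integrability is outside the technique class, which quantifies over arbitrary finite subgraphs: "The conjectured values for `γ` and `ν` in two dimensions arise from an exact solution" (Nienhuis's `O(n)`/Coulomb-gas solution on the hexagonal lattice) [cite: MadrasSlade1993, §1.6 Notes (p. 35)] [cite: Nienhuis1982, Abstract], on which nothing here bears (cf. the sibling barrier `NienhuisWeightsExcludeVertexSAW.lean` for what does); a fixed FUGACITY is no refuge for exact evaluation either (catalogue audit 2026-08-15): for a rational (or explicitly given algebraic) `x > 0`, `x ≠ 1`, exact values of the weighted two-point function `Z_{E,t}(x) = Σ_n c_n(E; 0, t) xⁿ` on arbitrary subgraphs give version (1) by a polynomial-time Turing reduction with `|V(E)|` oracle calls — dilating `E` by an integer factor `k ≥ 1` (each unit edge replaced by the straight lattice path of `k` unit edges: again a subgraph of `ℤ²`, the origin fixed, the new interior points private to their edge and of degree two) multiplies the length of every self-avoiding walk from the origin to the image `kt` of `t` by exactly `k` and creates no others (a walk cannot turn or stop inside a subdivided edge, both of its end points being vertex images), so `Z_{kE,kt}(x) = Z_{E,t}(x^k)`,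 and the values at the pairwise distinct points `x, x², …, x^{|V(E)|}` determine `c_0, …, c_{|V(E)|-1}` (all later coefficients vanish) by inverting a Vandermonde matrix over `ℚ(x)` [folklore: polynomial interpolation; informal, not formalised here]; at `x = 1` the weighted function is version (4) itself; what stays out of reach at the critical fugacity `x_c = 1/μ(ℤ²)` of the sub-problem is only that `x_c` has no known exact description, so that "exact evaluation at `x_c`" is not a posed computational problem to begin with; only versions (1) and (4) are formalised here (the other four are quoted); the encoding is this file's (any polynomial-time parsimoniously inter-reducible encoding gives the same completeness notion by Prop. 1) [cite: LiskiewiczOgiharaToda2003, Proposition 1]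
- status: established

[cite: LiskiewiczOgiharaToda2003, Theorem 7 (versions (1) and (4)), §2.2] -/
def GridSAWCountingSharpPComplete : Prop :=
  GridSAW.LOT2003_thm7_fixedLength ∧ GridSAW.LOT2003_thm7_anyLength

namespace GridSAW

/-- Unfolding: the barrier is Theorem 7 (1) ∧ (4), i.e. `#P`-membership of both counting
functions and `≤ᵖ_{r-shift}`-hardness. [cite: LiskiewiczOgiharaToda2003, Theorem 7] -/
theorem gridSAWCountingSharpPComplete_iff :
    GridSAWCountingSharpPComplete ↔
      (SAWCOUNT₁ ∈ SharpP ∧ ∀ f ∈ SharpP, RShiftReducible f SAWCOUNT₁) ∧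
        (SAWCOUNT₄ ∈ SharpP ∧ ∀ f ∈ SharpP, RShiftReducible f SAWCOUNT₄) :=
  Iff.rfl

/-- The consequence for the technique class, as a named statement: under the barrier, a
polynomial-time exact count (version (4)) puts every `#P` function in `FP` — compose the
reduction `R₁`, the counting procedure, and the right shift by `R₃(x)` bits. Recorded as a
statement, NOT proved here: closure of `FP` under composition and pairing is in the tree
(`Literature.Computability.Complexity.comp_mem_FP`, `Literature.Computability.Complexity.pairFn_mem_FP`); the one missing ingredient is a
lemma placing the binary right-shift map `⟨⌜a⌝, ⌜b⌝⟩ ↦ ⌜a div 2^b⌝` (`⌜·⌝ = encodeNat`, `b`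
given in binary, so possibly `b ≥ |⌜a⌝|`) in `FP`, which the tree did not have when this was
recorded. DISCHARGED since: `GridSAW.sharpP_subset_FP_of_hasPolyTimeSAWCount_holds`
(`GridSAWCountingSharpPCompleteProofs.lean`, which supplies that lemma as `GridSAW.divTwoPow_mem_FP`);
users' `(h : sharpP_subset_FP_of_hasPolyTimeSAWCount)` are fed that theorem.
[cite: LiskiewiczOgiharaToda2003, Theorem 7 and §2.2] [cite: AroraBarak2009, Def. 1.12–1.13] -/
def sharpP_subset_FP_of_hasPolyTimeSAWCount : Prop :=
  GridSAWCountingSharpPComplete → HasPolyTimeSAWCount →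
    ∀ f ∈ SharpP, (encodeNat ∘ f) ∈ FP

/-! ### Sanity checks on the objects (small instances) -/

/-- The one-edge graph `{(0,0)–(0,1)}` is a subgraph of the grid. [folklore] -/
theorem isGridSubgraph_singleEdge : IsGridSubgraph [((0, 0), (0, 1))] := by
  intro e he
  simp only [List.mem_singleton] at he
  subst he
  decide

/-- `(0,0)` and `(1,1)` are not joined by a grid edge (a diagonal). [folklore] -/
theorem not_isGridEdge_diagonal : ¬ IsGridEdge (0, 0) (1, 1) := by decide

/-- The two-vertex list `[(0,0), (0,1)]` is a SAW of the one-edge graph from the origin to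
`(0,1)` (non-vacuity of `sawsFromOriginTo`). [folklore] -/
theorem singleEdge_mem_sawsFromOriginTo :
    [((0 : ℤ), (0 : ℤ)), (0, 1)] ∈ sawsFromOriginTo [((0, 0), (0, 1))] (0, 1) := by
  refine ⟨⟨by simp, by simp, ?_, ?_⟩, rfl, rfl⟩
  · intro p hp
    simp only [List.mem_cons, List.not_mem_nil, or_false] at hp
    rcases hp with rfl | rfl <;> simp [vertexSet]
  · simp [Adj]

end GridSAW

end Literature.Barriers.CriticalPhenomena
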